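import Literature.RepresentationTheory.Virasoro.FockSingularVectors
import Mathlib.RingTheory.MvPolynomial.Symmetric.NewtonIdentities
import Mathlib.RingTheory.MvPolynomial.Homogeneous

/-!
# Non-vanishing of the screened singular vectors of Fock modules

We complete `Literature.RepresentationTheory.Virasoro.FockSingularVectors` by proving that the
screened vector `u = [z_1^g ⋯ z_r^g] Δ(z)^{2p} E_{rs}(β p(z))` (`g = (r-1)p + s`, `β ≠ 0`) is non-zero
(Iohara–Koga Proposition 4.4 proves this for `p = t` an odd prime `> r` by reduction modulo `t`; the
argument below works for every `p ≥ 1`):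

* `Fock.IsPal` — `ε`-palindromic polynomials (`[x^a]f = ε [x^b]f` for `a + b = w`, support below `w`);
  products of palindromic polynomials are palindromic (`IsPal.mul`), `z_i - z_j` is
  `(-1)`-palindromic, hence `Δ_ℤ = ∏_{i<j}(z_i - z_j)` is `±1`-palindromic with top exponent
  `(r-1)(1,…,1)` (`isPal_vandZ`; `sum_pairs_single_add_single`: every index lies in `r - 1` pairs),
  and the MIDDLE coefficient of the square of a non-zero `±1`-palindromic integral polynomial is
  `±` the sum of the squares of its coefficients, hence non-zero (`IsPal.coeff_mul_self_ne_zero`):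
  **`coeff_constExp_vand_pow_ne_zero`**: `[z_1^{(r-1)p} ⋯ z_r^{(r-1)p}] Δ^{2p} ≠ 0` (a Dyson-type
  constant term).
* `dIter_C_mul_E` — the iterated annihilators `∂_{x_{n_j}} ⋯ ∂_{x_{n_1}}` (`Σ nᵢ = rs`) map
  `Φ E_{rs}` to the scalar `Φ ∏ q_{nᵢ}/nᵢ` (Iohara–Koga Lemma 4.8: the coefficient of
  `f_{-s_1} ⋯ f_{-s_n}|η⟩`), so `u = 0` forces the linear form `f ↦ [z^{g𝟙}](Δ^{2p} f)` to vanish on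
  all products of power sums, i.e. (Newton's identities, `esymm_mem_psumAlg`) on all symmetric
  polynomials of the right degree, in particular on `e_r^s = (z_1⋯z_r)^s`, where it is the flat
  coefficient of `Δ^{2p}`: **`screeningVector_ne_zero`**.
* **`exists_singularVector_fock`**: for `p, r ≥ 1`, `β² = 2p`, `βλ = p - 1`, `βμ = (r+1)p - (s+1)`
  the Fock module `F_λ^μ` (`c = c(p) = 13 - 6p - 6/p`, `h = h_{r,s}(p)`) has a non-zero vector of
  level `rs` annihilated by `Vir⁺` (Iohara–Koga Lemma 4.11, proof).

## References

* [IoharaKoga2011] K. Iohara, Y. Koga, *Representation theory of the Virasoro algebra*, Springer 2011,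
  Lemma 4.8, Proposition 4.4, Lemma 4.11.
-/

noncomputable section

namespace Literature.RepresentationTheory.Virasoro

namespace Fock

open MvPolynomial

/-! ### Palindromic polynomials and the middle coefficient of their squares -/

section Pal

variable {σ : Type*} [DecidableEq σ] {K : Type*} [CommRing K]

/-- `f` is `ε`-**palindromic with top exponent `w`**: its support lies below `w` and
`[x^a] f = ε [x^b] f` whenever `a + b = w`. [folklore] -/
structure IsPal (ε : K) (w : σ →₀ ℕ) (f : MvPolynomial σ K) : Prop where
  /-- The reflection symmetry of the coefficients. -/
  symm : ∀ a b, a + b = w → coeff a f = ε * coeff b f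
  /-- The support lies below the top exponent. -/
  le : ∀ a, coeff a f ≠ 0 → a ≤ w

omit [DecidableEq σ] in
/-- `1` is `1`-palindromic with top exponent `0`. [folklore] -/
theorem isPal_one : IsPal (1 : K) (0 : σ →₀ ℕ) 1 := by
  classical
  refine ⟨fun a b hab => ?_, fun a ha => ?_⟩
  · have ha : a = 0 := le_antisymm (by rw [← hab]; exact le_self_add) bot_le
    have hb : b = 0 := le_antisymm (by rw [← hab]; exact le_add_self) bot_le
    rw [ha, hb, one_mul]
  · rw [coeff_one] at ha
    by_cases h0 : (0 : σ →₀ ℕ) = a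
    · rw [← h0]
    · rw [if_neg h0] at ha
      exact absurd rfl ha

/-- `z_i - z_j` (`i ≠ j`) is `(-1)`-palindromic with top exponent `e_i + e_j`. [folklore] -/
theorem isPal_X_sub_X {i j : σ} (hij : i ≠ j) :
    IsPal (-1 : K) (Finsupp.single i 1 + Finsupp.single j 1) (X i - X j : MvPolynomial σ K) := by
  classical
  have hc : ∀ a : σ →₀ ℕ, coeff a (X i - X j : MvPolynomial σ K) =
      (if Finsupp.single i 1 = a then 1 else 0) - (if Finsupp.single j 1 = a then 1 else 0) := by
    intro a; rw [coeff_sub, coeff_X, coeff_X]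
  have hne : (Finsupp.single i 1 : σ →₀ ℕ) ≠ Finsupp.single j 1 := fun h =>
    hij (Finsupp.single_left_injective one_ne_zero h)
  refine ⟨fun a b hab => ?_, fun a ha => ?_⟩
  · by_cases hai : Finsupp.single i 1 = a
    · subst hai
      have hb : b = Finsupp.single j 1 := add_left_cancel hab
      subst hb
      rw [hc, hc, if_pos rfl, if_neg (Ne.symm hne), if_neg hne, if_pos rfl]
      ring
    · by_cases haj : Finsupp.single j 1 = a
      · subst haj
        have hb : b = Finsupp.single i 1 := add_left_cancel (hab.trans (add_comm _ _))
        subst hb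
        rw [hc, hc, if_neg hne, if_pos rfl, if_pos rfl, if_neg (Ne.symm hne)]
        ring
      · -- then `b` is neither `e_i` nor `e_j`
        have hbi : Finsupp.single i 1 ≠ b := by
          intro hbi
          apply haj
          subst hbi
          exact (add_right_cancel (hab.trans (add_comm _ _))).symm
        have hbj : Finsupp.single j 1 ≠ b := by
          intro hbj
          apply hai
          subst hbj
          exact (add_right_cancel hab).symm
        rw [hc, hc, if_neg hai, if_neg haj, if_neg hbi, if_neg hbj]
        ring
  · rw [hc] at ha
    by_cases hai : Finsupp.single i 1 = a
    · rw [← hai]; exact le_self_add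
    · by_cases haj : Finsupp.single j 1 = a
      · rw [← haj]; exact le_add_self
      · rw [if_neg hai, if_neg haj, sub_zero] at ha; exact absurd rfl ha

/-- **Products of palindromic polynomials are palindromic** (signs multiply, top exponents add). [folklore] -/
theorem IsPal.mul {ε ε' : K} {w w' : σ →₀ ℕ} {f g : MvPolynomial σ K} (hf : IsPal ε w f) (hg : IsPal ε' w' g) :
    IsPal (ε * ε') (w + w') (f * g) := by
  classical
  -- the non-zero terms of `[x^a](fg) = Σ_{x+y=a} f_x g_y` have `x ≤ w`, `y ≤ w'`
  have hvan : ∀ a : σ →₀ ℕ, ∀ xy ∈ Finset.antidiagonal a, coeff xy.1 f * coeff xy.2 g ≠ 0 → xy.1 ≤ w ∧ xy.2 ≤ w' := by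
    intro a xy _ h
    exact ⟨hf.le _ (left_ne_zero_of_mul h), hg.le _ (right_ne_zero_of_mul h)⟩
  refine ⟨fun a b hab => ?_, fun a ha => ?_⟩
  · rw [coeff_mul, coeff_mul, ← Finset.sum_filter_of_ne (hvan a), ← Finset.sum_filter_of_ne (hvan b), Finset.mul_sum]
    refine Finset.sum_nbij' (fun xy => (w - xy.1, w' - xy.2)) (fun xy => (w - xy.1, w' - xy.2)) ?_ ?_ ?_ ?_ ?_
    · intro xy hxy
      simp only [Finset.mem_filter, Finset.mem_antidiagonal] at hxy ⊢
      refine ⟨?_, tsub_le_self, tsub_le_self⟩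
      ext k
      have h1 := DFunLike.congr_fun hxy.1 k
      have h2 := DFunLike.congr_fun hab k
      have h3 := Finsupp.le_def.mp hxy.2.1 k
      have h4 := Finsupp.le_def.mp hxy.2.2 k
      simp only [Finsupp.coe_add, Pi.add_apply, Finsupp.coe_tsub, Pi.sub_apply] at h1 h2 h3 h4 ⊢
      omega
    · intro xy hxy
      simp only [Finset.mem_filter, Finset.mem_antidiagonal] at hxy ⊢
      refine ⟨?_, tsub_le_self, tsub_le_self⟩
      ext k
      have h1 := DFunLike.congr_fun hxy.1 k
      have h2 := DFunLike.congr_fun hab k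
      have h3 := Finsupp.le_def.mp hxy.2.1 k
      have h4 := Finsupp.le_def.mp hxy.2.2 k
      simp only [Finsupp.coe_add, Pi.add_apply, Finsupp.coe_tsub, Pi.sub_apply] at h1 h2 h3 h4 ⊢
      omega
    · intro xy hxy
      simp only [Finset.mem_filter, Finset.mem_antidiagonal] at hxy
      ext k <;> simp only [Finsupp.coe_tsub, Pi.sub_apply]
      · have := Finsupp.le_def.mp hxy.2.1 k; omega
      · have := Finsupp.le_def.mp hxy.2.2 k; omega
    · intro xy hxy
      simp only [Finset.mem_filter, Finset.mem_antidiagonal] at hxy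
      ext k <;> simp only [Finsupp.coe_tsub, Pi.sub_apply]
      · have := Finsupp.le_def.mp hxy.2.1 k; omega
      · have := Finsupp.le_def.mp hxy.2.2 k; omega
    · intro xy hxy
      simp only [Finset.mem_filter, Finset.mem_antidiagonal] at hxy
      dsimp only
      rw [hf.symm xy.1 (w - xy.1) (add_tsub_cancel_of_le hxy.2.1), hg.symm xy.2 (w' - xy.2) (add_tsub_cancel_of_le hxy.2.2)]
      ring
  · rw [coeff_mul] at ha
    obtain ⟨xy, hxy, hne⟩ := Finset.exists_ne_zero_of_sum_ne_zero ha
    obtain ⟨h1, h2⟩ := hvan a xy hxy hne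
    rw [Finset.mem_antidiagonal] at hxy
    rw [← hxy]
    exact add_le_add h1 h2

/-- Powers of palindromic polynomials. [folklore] -/
theorem IsPal.pow {ε : K} {w : σ →₀ ℕ} {f : MvPolynomial σ K} (hf : IsPal ε w f) (n : ℕ) :
    IsPal (ε ^ n) (n • w) (f ^ n) := by
  induction n with
  | zero => simpa using (isPal_one (K := K) (σ := σ))
  | succ n ih => rw [pow_succ, pow_succ, succ_nsmul]; exact ih.mul hf

/-- Finite products of palindromic polynomials. [folklore] -/
theorem IsPal.prod {ι : Type*} (s : Finset ι) {ε : ι → K} {w : ι → σ →₀ ℕ} {F : ι → MvPolynomial σ K}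
    (h : ∀ e ∈ s, IsPal (ε e) (w e) (F e)) : IsPal (∏ e ∈ s, ε e) (∑ e ∈ s, w e) (∏ e ∈ s, F e) := by
  classical
  induction s using Finset.induction_on with
  | empty => simpa using (isPal_one (K := K) (σ := σ))
  | insert a s ha ih =>
    rw [Finset.prod_insert ha, Finset.sum_insert ha, Finset.prod_insert ha]
    exact (h a (Finset.mem_insert_self a s)).mul (ih fun e he => h e (Finset.mem_insert_of_mem he))

/-- **The middle coefficient of the square of a palindromic polynomial** is `ε` times the sum of
the squares of its coefficients: `[x^w](f²) = Σ_{x+y=w} f_x f_y = ε Σ_y f_y²`. [folklore] -/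
theorem IsPal.coeff_mul_self {ε : K} {w : σ →₀ ℕ} {f : MvPolynomial σ K} (hf : IsPal ε w f) :
    coeff w (f * f) = ε * ∑ xy ∈ Finset.antidiagonal w, coeff xy.2 f * coeff xy.2 f := by
  rw [coeff_mul, Finset.mul_sum]
  refine Finset.sum_congr rfl fun xy hxy => ?_
  rw [Finset.mem_antidiagonal] at hxy
  rw [hf.symm xy.1 xy.2 hxy, mul_assoc]

/-- Over `ℤ`: a non-zero `±1`-palindromic polynomial has a non-zero middle coefficient of its square
(a signed sum of squares of ALL its coefficients). [folklore] -/
theorem IsPal.coeff_mul_self_ne_zero {ε : ℤ} (hε : ε = 1 ∨ ε = -1) {w : σ →₀ ℕ} {f : MvPolynomial σ ℤ}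
    (hf : IsPal ε w f) (hf0 : f ≠ 0) : coeff w (f * f) ≠ 0 := by
  rw [hf.coeff_mul_self]
  obtain ⟨y, hy⟩ : ∃ y, coeff y f ≠ 0 := by
    by_contra h
    push Not at h
    exact hf0 (MvPolynomial.ext _ _ fun y => by rw [h y, coeff_zero])
  have hmem : (w - y, y) ∈ Finset.antidiagonal w := by
    rw [Finset.mem_antidiagonal]
    exact tsub_add_cancel_of_le (hf.le y hy)
  have hpos : 0 < ∑ xy ∈ Finset.antidiagonal w, coeff xy.2 f * coeff xy.2 f :=
    lt_of_lt_of_le (mul_self_pos.mpr hy)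
      (Finset.single_le_sum (f := fun xy : (σ →₀ ℕ) × (σ →₀ ℕ) => coeff xy.2 f * coeff xy.2 f)
        (fun xy _ => mul_self_nonneg _) hmem)
  rcases hε with rfl | rfl
  · rw [one_mul]; exact hpos.ne'
  · rw [neg_one_mul, neg_ne_zero]; exact hpos.ne'

end Pal

/-! ### The flat coefficient of `Δ^{2p}` does not vanish -/

section Vandermonde

variable {r : ℕ}

/-- The integral Vandermonde product `Δ_ℤ = ∏_{i<j} (z_i - z_j) ∈ ℤ[z_1, …, z_r]`. [folklore] -/
def vandZ (r : ℕ) : MvPolynomial (Fin r) ℤ :=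
  ∏ i : Fin r, ∏ j ∈ Finset.univ.filter (fun j => i < j), (X i - X j)

/-- `Δ_ℤ ↦ Δ` under `ℤ → ℂ`. [folklore] -/
theorem map_vandZ : MvPolynomial.map (Int.castRingHom ℂ) (vandZ r) = vand r := by
  simp only [vandZ, vand, map_prod, map_sub, map_X]

/-- `#{j : k < j} + #{i : i < k} = r - 1` in `Fin r`. [folklore] -/
theorem card_filter_gt_add_card_filter_lt (k : Fin r) :
    (Finset.univ.filter fun j : Fin r => k < j).card + (Finset.univ.filter fun i : Fin r => i < k).card = r - 1 := by
  rw [← Finset.card_union_of_disjoint (Finset.disjoint_filter.mpr fun j _ h1 h2 => lt_asymm h1 h2),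
    ← Finset.filter_or]
  have : (Finset.univ.filter fun j : Fin r => k < j ∨ j < k) = Finset.univ.filter fun j => j ≠ k := by
    ext j
    simp only [Finset.mem_filter, Finset.mem_univ, true_and]
    constructor
    · rintro (h | h); exacts [h.ne', h.ne]
    · intro h; exact (lt_or_gt_of_ne h).symm
  rw [this, Finset.filter_ne', Finset.card_erase_of_mem (Finset.mem_univ k), Finset.card_univ, Fintype.card_fin]

/-- The sum of the exponents `e_i + e_j` over the pairs `i < j` is `(r - 1)(1, …, 1)`: every index
lies in exactly `r - 1` pairs. [folklore] -/
theorem sum_pairs_single_add_single :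
    ∑ i : Fin r, ∑ j ∈ Finset.univ.filter (fun j => i < j), (Finsupp.single i 1 + Finsupp.single j 1 : Fin r →₀ ℕ) =
      (r - 1) • constExp r 1 := by
  classical
  ext k
  simp only [Finsupp.coe_finsetSum, Finset.sum_apply, Finsupp.coe_add, Pi.add_apply, Finsupp.single_apply,
    Finsupp.coe_smul, Pi.smul_apply, constExp_apply, smul_eq_mul, mul_one, Finset.sum_add_distrib]
  -- `Σ_i Σ_{j>i} [i = k] = #{j : k < j}`
  have h1 : ∑ i : Fin r, ∑ j ∈ Finset.univ.filter (fun j => i < j), (if i = k then 1 else 0) =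
      (Finset.univ.filter fun j : Fin r => k < j).card := by
    simp_rw [Finset.sum_const, smul_eq_mul, mul_ite, mul_one, mul_zero]
    rw [Finset.sum_ite_eq', if_pos (Finset.mem_univ k)]
  -- `Σ_i Σ_{j>i} [j = k] = #{i : i < k}`
  have h2 : ∑ i : Fin r, ∑ j ∈ Finset.univ.filter (fun j => i < j), (if j = k then 1 else 0) =
      (Finset.univ.filter fun i : Fin r => i < k).card := by
    have : ∀ i : Fin r, ∑ j ∈ Finset.univ.filter (fun j => i < j), (if j = k then (1 : ℕ) else 0) =
        if i < k then 1 else 0 := by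
      intro i
      rw [Finset.sum_ite_eq']
      simp only [Finset.mem_filter, Finset.mem_univ, true_and]
    simp_rw [this]
    rw [Finset.card_eq_sum_ones, Finset.sum_filter]
  rw [h1, h2, card_filter_gt_add_card_filter_lt]

/-- Twice the number of pairs `i < j` is `r(r - 1)`. [folklore] -/
theorem two_mul_card_pairs :
    2 * ∑ i : Fin r, (Finset.univ.filter fun j : Fin r => i < j).card = r * (r - 1) := by
  have h := congrArg Finsupp.degree (sum_pairs_single_add_single (r := r))
  simp only [map_sum, map_add, Finsupp.degree_single, map_nsmul] at h
  have hdeg : Finsupp.degree (constExp r 1) = r := by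
    rw [Finsupp.degree]
    change ∑ i ∈ (constExp r 1).support, constExp r 1 i = r
    have hsupp : (constExp r 1).support = Finset.univ := by
      ext i; simp [Finsupp.mem_support_iff, constExp_apply]
    rw [hsupp]
    simp
  rw [hdeg, smul_eq_mul] at h
  simp only [Finset.sum_const, smul_eq_mul] at h
  have h' : ∑ i : Fin r, 2 * (Finset.univ.filter fun j : Fin r => i < j).card = (r - 1) * r := by
    rw [← h]
    exact Finset.sum_congr rfl fun i _ => by ring
  rw [Finset.mul_sum, h', mul_comm]

/-- **`Δ_ℤ` is palindromic**: `±1`-palindromic with top exponent `(r-1)(1, …, 1)`. [folklore] -/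
theorem isPal_vandZ : ∃ ε : ℤ, (ε = 1 ∨ ε = -1) ∧ IsPal ε ((r - 1) • constExp r 1) (vandZ r) := by
  classical
  refine ⟨∏ i : Fin r, ∏ j ∈ Finset.univ.filter (fun j => i < j), (-1 : ℤ), ?_, ?_⟩
  · simp only [Finset.prod_const]
    rw [Finset.prod_pow_eq_pow_sum]
    exact (neg_one_pow_eq_or ℤ _)
  · rw [← sum_pairs_single_add_single, vandZ]
    refine IsPal.prod _ fun i _ => IsPal.prod _ fun j hj => ?_
    rw [Finset.mem_filter] at hj
    exact isPal_X_sub_X hj.2.ne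

/-- `Δ_ℤ ≠ 0`. [folklore] -/
theorem vandZ_ne_zero : vandZ r ≠ 0 := by
  rw [vandZ]
  refine Finset.prod_ne_zero_iff.mpr fun i _ => Finset.prod_ne_zero_iff.mpr fun j hj => ?_
  rw [Finset.mem_filter] at hj
  exact sub_ne_zero.mpr fun h => hj.2.ne (X_injective h)

/-- `n • (r-1)(1,…,1) = (n(r-1))(1,…,1)`. [folklore] -/
theorem smul_constExp (n g : ℕ) : n • constExp r g = constExp r (n * g) := by
  ext i; simp [constExp_apply]

/-- **The flat coefficient of `Δ^{2p}` does not vanish** (a Dyson-type constant term; here from the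
palindromic symmetry of `Δ^p`: it is `±` the sum of the squares of the coefficients of `Δ^p`):
`[z_1^{(r-1)p} ⋯ z_r^{(r-1)p}] Δ(z)^{2p} ≠ 0`.
[cite: IoharaKoga2011, Proposition 4.4 (proof: c_ν̃ ≠ 0 for ν̃ = (t(n-1), …, t(n-1)), there for odd primes t)] -/
theorem coeff_constExp_vand_pow_ne_zero (p : ℕ) :
    coeff (constExp r ((r - 1) * p)) (vand r ^ (2 * p)) ≠ 0 := by
  obtain ⟨ε, hε, hpal⟩ := isPal_vandZ (r := r)
  have hpalp := hpal.pow p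
  rw [smul_smul, smul_constExp, mul_one, mul_comm p] at hpalp
  have hεp : ε ^ p = 1 ∨ ε ^ p = -1 := by
    rcases hε with rfl | rfl
    · left; exact one_pow p
    · exact neg_one_pow_eq_or ℤ p
  have hZ := hpalp.coeff_mul_self_ne_zero hεp (pow_ne_zero p vandZ_ne_zero)
  rw [← pow_add, ← two_mul] at hZ
  rw [← map_vandZ, ← map_pow, coeff_map]
  exact (map_ne_zero_iff (Int.castRingHom ℂ) Int.cast_injective).mpr hZ

end Vandermonde

/-! ### Iterated annihilators and the coefficient criterion -/

section Criterion

variable {R : Type*} [CommRing R] [Algebra ℂ R]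

variable (R) in
/-- The iterated annihilation derivations `∂_{n_j} ⋯ ∂_{n_1}` along a list `[n_1, …, n_j]`. [folklore] -/
def dIter (l : List ℕ) (v : Space R) : Space R := l.foldl (fun w n => d R n w) v

omit [Algebra ℂ R] in
/-- Unfolding on the empty list. [folklore] -/
@[simp] theorem dIter_nil (v : Space R) : dIter R [] v = v := rfl

omit [Algebra ℂ R] in
/-- Unfolding on a non-empty list. [folklore] -/
theorem dIter_cons (n : ℕ) (l : List ℕ) (v : Space R) : dIter R (n :: l) v = dIter R l (d R n v) := rfl

omit [Algebra ℂ R] in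
/-- `dIter` kills `0`. [folklore] -/
theorem dIter_zero (l : List ℕ) : dIter R l 0 = 0 := by
  induction l with
  | nil => rfl
  | cons n l ih => rw [dIter_cons, map_zero, ih]

/-- **Iterated annihilators on the (twisted) coherent family**: for positive `n_i` with
`Σ n_i ≤ M`, `∂_{n_j} ⋯ ∂_{n_1} (Φ E_M) = Φ ∏_i (q_{n_i}/n_i) · E_{M - Σ n_i}`. [cite: IoharaKoga2011, Lemma 4.8 (proof: coefficient of f_{-s_1}⋯f_{-s_n}|η⟩)] -/
theorem dIter_C_mul_E (q : ℕ → R) (l : List ℕ) (hl : ∀ n ∈ l, 0 < n) (Φ : R) (M : ℕ) (hM : l.sum ≤ M) :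
    dIter R l (C Φ * E q M) = C (Φ * (l.map fun n => ninv R n * q n).prod) * E q (M - l.sum) := by
  induction l generalizing Φ M with
  | nil => simp
  | cons n l ih =>
    have hn : 0 < n := hl n List.mem_cons_self
    rw [List.sum_cons] at hM
    rw [dIter_cons, d_C_mul, d_E q hn, if_pos (by omega), ← mul_assoc, ← map_mul,
      ih (fun m hm => hl m (List.mem_cons_of_mem n hm)) _ _ (by omega), List.map_cons, List.prod_cons,
      List.sum_cons, show M - n - l.sum = M - (n + l.sum) by omega, mul_assoc]

variable {r : ℕ}

/-- The extraction commutes with the iterated annihilators. [folklore] -/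
theorem extract_dIter (g : ℕ) (l : List ℕ) (v : Space (ZRing r)) :
    extract r g (dIter (ZRing r) l v) = dIter ℂ l (extract r g v) := by
  induction l generalizing v with
  | nil => rfl
  | cons n l ih => rw [dIter_cons, dIter_cons, ih, extract, coeffMapₗ_d]

/-- The extraction of a constant polynomial. [folklore] -/
theorem extract_C (g : ℕ) (f : ZRing r) : extract r g (C f) = C (coeff (constExp r g) f) := by
  rw [extract, C_apply, coeffMapₗ_monomial, lcoeff_apply, C_apply]

end Criterion

/-! ### Power sums generate the symmetric functions (Newton) -/

section Newton

variable {r : ℕ}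

/-- The subalgebra of `ℂ[z_1, …, z_r]` generated by the power sums `p_n`, `n ≥ 1`. [folklore] -/
def psumAlg (r : ℕ) : Subalgebra ℂ (ZRing r) :=
  Algebra.adjoin ℂ {f | ∃ n, 0 < n ∧ f = psum (Fin r) ℂ n}

/-- The power sums of positive degree lie in `psumAlg`. [folklore] -/
theorem psum_mem_psumAlg {n : ℕ} (hn : 0 < n) : psum (Fin r) ℂ n ∈ psumAlg r :=
  Algebra.subset_adjoin ⟨n, hn, rfl⟩

/-- **Newton's identities**: every elementary symmetric polynomial is a polynomial (over `ℚ ⊂ ℂ`) in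
the power sums. [folklore] -/
theorem esymm_mem_psumAlg (k : ℕ) : esymm (Fin r) ℂ k ∈ psumAlg r := by
  induction k using Nat.strong_induction_on with
  | _ k ih =>
  rcases Nat.eq_zero_or_pos k with rfl | hk
  · rw [esymm_zero]; exact Subalgebra.one_mem _
  · have h := mul_esymm_eq_sum (Fin r) ℂ k
    have hmem : (k : ZRing r) * esymm (Fin r) ℂ k ∈ psumAlg r := by
      rw [h]
      refine Subalgebra.mul_mem _ (Subalgebra.pow_mem _ (Subalgebra.neg_mem _ (Subalgebra.one_mem _)) _)
        (Subalgebra.sum_mem _ fun a ha => ?_)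
      rw [Finset.mem_filter, Finset.mem_antidiagonal] at ha
      refine Subalgebra.mul_mem _ (Subalgebra.mul_mem _
        (Subalgebra.pow_mem _ (Subalgebra.neg_mem _ (Subalgebra.one_mem _)) _) (ih a.1 ha.2)) ?_
      exact psum_mem_psumAlg (by omega)
    have e : esymm (Fin r) ℂ k = ((k : ℂ)⁻¹) • ((k : ZRing r) * esymm (Fin r) ℂ k) := by
      rw [← map_natCast (C : ℂ →+* ZRing r) k, ← smul_eq_C_mul, smul_smul,
        inv_mul_cancel₀ (Nat.cast_ne_zero.mpr (by omega)), one_smul]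
    rw [e]
    exact Subalgebra.smul_mem _ hmem _

/-- `z_1 ⋯ z_r = e_r`. [folklore] -/
theorem prod_X_eq_esymm : (∏ i : Fin r, X i : ZRing r) = esymm (Fin r) ℂ r := by
  have h : Finset.powersetCard r (Finset.univ : Finset (Fin r)) = {Finset.univ} := by
    have := Finset.powersetCard_self (Finset.univ : Finset (Fin r))
    rwa [Finset.card_univ, Fintype.card_fin] at this
  rw [esymm, h, Finset.sum_singleton]

/-- `(z_1 ⋯ z_r)^s ∈ psumAlg`. [folklore] -/
theorem prod_X_pow_mem_psumAlg (s : ℕ) : (∏ i : Fin r, X i : ZRing r) ^ s ∈ psumAlg r := by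
  rw [prod_X_eq_esymm]
  exact Subalgebra.pow_mem _ (esymm_mem_psumAlg r) s

/-- Elements of `psumAlg` are linear combinations of products of power sums of positive degree. [folklore] -/
theorem psumAlg_induction {P : ZRing r → Prop} (hprod : ∀ l : List ℕ, (∀ n ∈ l, 0 < n) → P (l.map (psum (Fin r) ℂ)).prod)
    (hzero : P 0) (hadd : ∀ f g, P f → P g → P (f + g)) (hsmul : ∀ (c : ℂ) f, P f → P (c • f)) {f : ZRing r}
    (hf : f ∈ psumAlg r) : P f := by
  have hf' : f ∈ Subalgebra.toSubmodule (psumAlg r) := hf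
  rw [psumAlg, Algebra.adjoin_eq_span] at hf'
  clear hf
  induction hf' using Submodule.span_induction with
  | mem x hx =>
    -- `x` is a finite product of generators
    have key : ∀ y ∈ Submonoid.closure {f : ZRing r | ∃ n, 0 < n ∧ f = psum (Fin r) ℂ n},
        ∃ l : List ℕ, (∀ n ∈ l, 0 < n) ∧ y = (l.map (psum (Fin r) ℂ)).prod := by
      intro y hy
      induction hy using Submonoid.closure_induction with
      | mem z hz =>
        obtain ⟨n, hn, rfl⟩ := hz
        exact ⟨[n], by simpa using hn, by simp⟩
      | one => exact ⟨[], by simp, by simp⟩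
      | mul y z _ _ hy hz =>
        obtain ⟨l₁, hl₁, rfl⟩ := hy
        obtain ⟨l₂, hl₂, rfl⟩ := hz
        refine ⟨l₁ ++ l₂, fun n hn => ?_, by rw [List.map_append, List.prod_append]⟩
        rcases List.mem_append.mp hn with h | h
        exacts [hl₁ n h, hl₂ n h]
    obtain ⟨l, hl, rfl⟩ := key x hx
    exact hprod l hl
  | zero => exact hzero
  | add f g _ _ hf hg => exact hadd f g hf hg
  | smul c f _ hf => exact hsmul c f hf

end Newton

/-! ### Non-vanishing of the screened vector -/

section Nonzero

variable {r : ℕ}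

/-- `Δ` is homogeneous of degree the number of pairs. [folklore] -/
theorem isHomogeneous_vand :
    (vand r).IsHomogeneous (∑ i : Fin r, (Finset.univ.filter fun j : Fin r => i < j).card) := by
  rw [vand]
  refine IsHomogeneous.prod _ _ _ fun i _ => ?_
  rw [Finset.card_eq_sum_ones]
  exact IsHomogeneous.prod _ _ _ fun j _ => (isHomogeneous_X ℂ i).sub (isHomogeneous_X ℂ j)

/-- The power sums are homogeneous. [folklore] -/
theorem isHomogeneous_psum (n : ℕ) : (psum (Fin r) ℂ n).IsHomogeneous n := by
  rw [psum]
  have := IsHomogeneous.sum Finset.univ (fun i : Fin r => (X i : ZRing r) ^ n) n fun i _ => isHomogeneous_X_pow i n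
  exact this

/-- Products of power sums along a list are homogeneous of degree the sum of the list. [folklore] -/
theorem isHomogeneous_prod_psum (l : List ℕ) : ((l.map (psum (Fin r) ℂ)).prod).IsHomogeneous l.sum := by
  induction l with
  | nil => exact isHomogeneous_one (Fin r) ℂ
  | cons n l ih => rw [List.map_cons, List.prod_cons, List.sum_cons]; exact (isHomogeneous_psum n).mul ih

/-- The degree of the constant exponent vector. [folklore] -/
theorem degree_constExp (g : ℕ) : Finsupp.degree (constExp r g) = r * g := by
  change ∑ i ∈ (constExp r g).support, constExp r g i = r * g
  rcases Nat.eq_zero_or_pos g with rfl | hg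
  · simp [constExp_apply]
  · have hsupp : (constExp r g).support = Finset.univ := by
      ext i; simp [Finsupp.mem_support_iff, constExp_apply, hg.ne']
    rw [hsupp]
    simp [constExp_apply]

/-- The coherent data `(1/n) q_n = (β/n) p_n` of the screened family. [folklore] -/
theorem ninv_mul_qSeq (β : ℂ) (n : ℕ) :
    ninv (ZRing r) n * qSeq r β n = C ((n : ℂ)⁻¹ * β) * psum (Fin r) ℂ n := by
  rw [ninv, qSeq, Algebra.smul_def, MvPolynomial.algebraMap_eq, map_mul, mul_assoc]

/-- Along a list: `∏ (q_{n}/n) = (∏ β/n) · ∏ p_n`. [folklore] -/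
theorem prod_ninv_mul_qSeq (β : ℂ) (l : List ℕ) :
    (l.map fun n => ninv (ZRing r) n * qSeq r β n).prod =
      C ((l.map fun n : ℕ => (n : ℂ)⁻¹ * β).prod) * (l.map (psum (Fin r) ℂ)).prod := by
  simp_rw [ninv_mul_qSeq]
  rw [List.prod_map_mul, map_list_prod, List.map_map]
  rfl

/-- `(z_1 ⋯ z_r)^s` is the monomial of the constant exponent `(s, …, s)`. [folklore] -/
theorem prod_X_pow_eq_monomial (s : ℕ) : (∏ i : Fin r, X i : ZRing r) ^ s = monomial (constExp r s) 1 := by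
  rw [monomial_eq, C_1, one_mul, Finsupp.prod]
  rcases Nat.eq_zero_or_pos s with rfl | hs
  · rw [pow_zero]
    have hsupp : (constExp r 0).support = ∅ := by ext i; simp [constExp_apply]
    rw [hsupp, Finset.prod_empty]
  · have hsupp : (constExp r s).support = Finset.univ := by
      ext i; simp [Finsupp.mem_support_iff, constExp_apply, hs.ne']
    rw [hsupp, ← Finset.prod_pow]
    exact Finset.prod_congr rfl fun i _ => by rw [constExp_apply]

/-- Shifting the extracted exponent by `(s, …, s)`: `[z^{(g+s)𝟙}] (Φ (z_1⋯z_r)^s) = [z^{g𝟙}] Φ`. [folklore] -/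
theorem coeff_constExp_mul_prod_X_pow (Φ : ZRing r) (g s : ℕ) :
    coeff (constExp r (g + s)) (Φ * (∏ i : Fin r, X i) ^ s) = coeff (constExp r g) Φ := by
  rw [prod_X_pow_eq_monomial, coeff_mul_monomial', mul_one, if_pos (Finsupp.le_def.mpr fun i => by simp [constExp_apply])]
  congr 1
  ext i
  simp [constExp_apply]

/-- **The screened vector does not vanish** (`p, r ≥ 1`, `β ≠ 0`): applying the annihilators
`∂_{x_{n_j}} ⋯ ∂_{x_{n_1}}` (`Σ n_i = rs`) to `u = [z^{g𝟙}] Δ^{2p} E_{rs}` gives the numbers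
`(∏ β/n_i) [z^{g𝟙}] (Δ^{2p} p_{n_1} ⋯ p_{n_j})`; if `u = 0` the linear form `f ↦ [z^{g𝟙}](Δ^{2p} f)`
would vanish on all products of power sums (by degree reasons when `Σ n_i ≠ rs`), hence on the algebra
they generate, which contains `(z_1 ⋯ z_r)^s = e_r^s` by Newton's identities — but
`[z^{g𝟙}](Δ^{2p} (z_1⋯z_r)^s) = [z^{((r-1)p)𝟙}] Δ^{2p} ≠ 0`.
[cite: IoharaKoga2011, Lemma 4.8 and Proposition 4.4 (non-triviality of (Σ_√N)^n.|η - n√N⟩; there for odd primes t = p > n)] -/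
theorem screeningVector_ne_zero (p s : ℕ) {β : ℂ} (hβ : β ≠ 0) :
    screeningVector r p β ((r - 1) * p + s) (r * s) ≠ 0 := by
  classical
  intro hu
  set g := (r - 1) * p + s with hg
  set Φ : ZRing r := vand r ^ (2 * p) with hΦ
  -- Step 1: the linear form `f ↦ [z^{g𝟙}](Φ f)` kills all products of power sums of positive degree
  have hprod : ∀ l : List ℕ, (∀ n ∈ l, 0 < n) → coeff (constExp r g) (Φ * (l.map (psum (Fin r) ℂ)).prod) = 0 := by
    intro l hl
    by_cases hsum : l.sum = r * s
    · -- apply the annihilators along `l` to `u = 0`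
      have h1 : dIter ℂ l (screeningVector r p β g (r * s)) = 0 := by rw [hu, dIter_zero]
      rw [screeningVector, ← extract_dIter, screenedFamily, dIter_C_mul_E _ l hl _ _ hsum.le, hsum, Nat.sub_self,
        E_zero, mul_one, extract_C, prod_ninv_mul_qSeq, ← mul_assoc, mul_comm (vand r ^ (2 * p)), mul_assoc,
        coeff_C_mul, C_eq_zero, mul_eq_zero] at h1
      rcases h1 with h1 | h1
      · exfalso
        refine (List.prod_ne_zero fun h0 => ?_) h1
        obtain ⟨n, hn, hn0⟩ := List.mem_map.mp h0
        exact mul_ne_zero (inv_ne_zero (Nat.cast_ne_zero.mpr (hl n hn).ne')) hβ hn0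
      · exact h1
    · -- degree reasons
      refine IsHomogeneous.coeff_eq_zero ((isHomogeneous_vand.pow (2 * p)).mul (isHomogeneous_prod_psum l)) ?_
      rw [degree_constExp]
      have h2 := two_mul_card_pairs (r := r)
      intro h
      apply hsum
      -- `r g = 2p · #pairs + r s`
      have e1 : r * g = r * ((r - 1) * p) + r * s := by rw [hg, mul_add]
      have e2 : r * ((r - 1) * p) = (∑ i : Fin r, (Finset.univ.filter fun j : Fin r => i < j).card) * (2 * p) := by
        rw [← mul_assoc, ← h2]; ring
      omega
  -- Step 2: hence it kills the algebra generated by them, in particular `(z_1 ⋯ z_r)^s`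
  have halg : ∀ f ∈ psumAlg r, coeff (constExp r g) (Φ * f) = 0 := by
    intro f hf
    refine psumAlg_induction (P := fun f => coeff (constExp r g) (Φ * f) = 0) hprod ?_ ?_ ?_ hf
    · rw [mul_zero, coeff_zero]
    · intro f₁ f₂ h₁ h₂; rw [mul_add, coeff_add, h₁, h₂, add_zero]
    · intro c f h; rw [mul_smul_comm, coeff_smul, h, smul_zero]
  have hcontra := halg _ (prod_X_pow_mem_psumAlg s)
  -- Step 3: but this coefficient is the flat coefficient of `Δ^{2p}`
  rw [hg, coeff_constExp_mul_prod_X_pow] at hcontra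
  exact coeff_constExp_vand_pow_ne_zero p hcontra

/-- **Singular vectors of the Fock modules `F_λ^μ` at `c = c(p)`, `h = h_{r,s}(p)` (`p, r ≥ 1`).**
For `β² = 2p`, `βλ = p - 1` and `βμ = (r+1)p - (s+1)` the Fock module `F_λ^μ`
(`c_λ = 1 - 12λ² = 13 - 6p - 6/p`, `h = ½μ(μ-2λ) = h_{r,s}(p)`) contains a NON-ZERO vector `u` of
level `rs` annihilated by `Vir⁺`, i.e. a singular vector of weight `h + rs`.
[cite: IoharaKoga2011, Lemma 4.11 (proof) with Proposition 4.4 and Lemma 4.5] -/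
theorem exists_singularVector_fock (p r s : ℕ) (hp : 0 < p) (hr : 0 < r) {β lam mu : ℂ} (hβ : β ^ 2 = 2 * p)
    (hl : β * lam = p - 1) (hm : β * mu = (r + 1) * p - (s + 1)) :
    ∃ u : Space ℂ, u ≠ 0 ∧ IsWeightedHomogeneous lw u (r * s) ∧
      (∀ n : ℤ, 0 < n → (rep (R := ℂ) lam mu).L n u = 0) ∧
      (rep (R := ℂ) lam mu).L 0 u = (mu * (mu - 2 * lam) / 2 + (r * s : ℕ)) • u := by
  have hβ0 : β ≠ 0 := by
    rintro rfl
    rw [zero_pow two_ne_zero] at hβ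
    have : (p : ℂ) = 0 := by linear_combination -hβ / 2
    exact hp.ne' (by exact_mod_cast this)
  obtain ⟨h1, h2⟩ := screeningVector_singular p s hr hβ hl hm
  exact ⟨_, screeningVector_ne_zero p s hβ0, isWeightedHomogeneous_screeningVector p β _ _, h1, h2⟩

end Nonzero

end Fock

end Literature.RepresentationTheory.Virasoro

end
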